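import Mathlib
import Literature.Probability.LatticeModels.GKSInequalities
import Summits.CriticalPhenomena.Ising3DConformalLimit.Theorems.PrecisionLaplacianInverseMFerromagnetEntryNonposOfPcov
import Summits.CriticalPhenomena.Ising3DConformalLimit.Theorems.PrecisionLaplacianInverseMFerromagnetImOfImDeg3
import HarnessLib

/-!
# The amputated Lebowitz charge at a coincident triple

Tooth `stub_amputatedLebowitz_degenerate` of line `Sketch` (card `amputated-lebowitz-vertex-measure`) of
crux stmt-CriticalPhenomena-4801 `PrecisionLaplacian.MoebiusLimitOfTwoPointLaw`.

THEOREM-ONLY file.  Let `Σ = (⟨σ_pσ_q⟩)_{p,q}` be the spin second-moment matrix of the zero-field pair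
ferromagnet `gksExpect univ K C` on `Fin n` (`Kᵢ ≥ 0`, `|Cᵢ| = 2`), and for sites `z, x₂, x₃, x₄` let

  `ν(z) = ∑ₐ (Σ⁻¹)_{z a} (⟨σ_aσ_{x₂}⟩⟨σ_{x₃}σ_{x₄}⟩ + ⟨σ_aσ_{x₃}⟩⟨σ_{x₂}σ_{x₄}⟩ + ⟨σ_aσ_{x₄}⟩⟨σ_{x₂}σ_{x₃}⟩
            − ⟨σ_aσ_{x₂}σ_{x₃}σ_{x₄}⟩)`

be the VP¹ charge (one-leg precision amputation of `−U₄`).  If `x₂, x₃, x₄` are NOT pairwise distinct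
the charge is explicit and nonnegative: `Σ` is positive definite (`schur_posDef`), so `Σ⁻¹Σ = 1`, i.e.
`∑ₐ (Σ⁻¹)_{z a} ⟨σ_aσ_x⟩ = δ_{z x}`; and when two of the three sites coincide, `σ_p² = 1` collapses the
four-point column to a two-point column which cancels one Wick column, the other two Wick columns being
equal columns of `Σ`.  E.g. for `x₃ = x₄`: `ν(z) = 2⟨σ_{x₂}σ_{x₃}⟩ δ_{z x₃} ≥ 0` by GKS I (`c5_corr_nonneg`).
-/

noncomputable section

namespace Summit.CriticalPhenomena.Ising3DConformalLimit.PrecisionLaplacianMoebiusLimitOfTwoPointLaw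

open Literature.Probability.LatticeModels Finset Matrix
open Summit.CriticalPhenomena.Ising3DConformalLimit.Cruxes.InverseMFerromagnet.PartialCovarianceLadder
  (schur_posDef c5_corr_nonneg)

/-- `⟨σ_xσ_x⟩ = ⟨1⟩ = 1`. -/
theorem ampLebDeg_corr_self {V ι : Type*} [Fintype V] [DecidableEq V] [Fintype ι] (K : ι → ℝ)
    (C : ι → Finset V) (x : V) :
    gksExpect Finset.univ K C (fun ω => spinAt x ω * spinAt x ω) = 1 := by
  simp only [spinAt_mul_self]
  unfold gksExpect
  exact div_self (gksSum_one_pos _ _ _).ne'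

/-- `⟨σ_pσ_q⟩ = ⟨σ_qσ_p⟩`. -/
theorem ampLebDeg_corr_comm {V ι : Type*} [Fintype V] [DecidableEq V] [Fintype ι] (K : ι → ℝ)
    (C : ι → Finset V) (p q : V) :
    gksExpect Finset.univ K C (fun ω => spinAt p ω * spinAt q ω) =
      gksExpect Finset.univ K C (fun ω => spinAt q ω * spinAt p ω) :=
  congrArg _ (funext fun ω => mul_comm (spinAt p ω) (spinAt q ω))

/-- Amputation of a column of `Σ` by `Σ⁻¹` gives a Kronecker delta:
`∑ₐ (Σ⁻¹)_{z a} (c ⟨σ_aσ_x⟩) = c δ_{z x}` (`Σ` is positive definite, `schur_posDef`, so `Σ⁻¹Σ = 1`). -/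
theorem ampLebDeg_sum_inv_mul_col (n m : ℕ) (K : Fin m → ℝ) (C : Fin m → Finset (Fin n))
    (z x : Fin n) (c : ℝ) :
    ∑ a : Fin n,
        (Matrix.of fun (p q : Fin n) =>
            gksExpect Finset.univ K C (fun ω => spinAt p ω * spinAt q ω))⁻¹ z a *
          (c * gksExpect Finset.univ K C (fun ω => spinAt a ω * spinAt x ω)) =
      c * (if z = x then 1 else 0) := by
  have hpd := schur_posDef n m K C
  have hdet : IsUnit (Matrix.of fun (p q : Fin n) =>
      gksExpect Finset.univ K C (fun ω => spinAt p ω * spinAt q ω)).det :=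
    (Matrix.isUnit_iff_isUnit_det _).mp hpd.isUnit
  have h1 := Matrix.nonsing_inv_mul _ hdet
  have hzx := congrFun (congrFun h1 z) x
  rw [Matrix.mul_apply, Matrix.one_apply] at hzx
  simp only [Matrix.of_apply] at hzx
  rw [← hzx, Finset.mul_sum]
  exact Finset.sum_congr rfl fun a _ => by ring

/-- The case `x₃ = x₄`: `ν(z) = 2⟨σ_{x₂}σ_{x₃}⟩ δ_{z x₃} ≥ 0`. -/
theorem ampLebDeg_case34 (n m : ℕ) (K : Fin m → ℝ) (C : Fin m → Finset (Fin n)) (hK : ∀ i, 0 ≤ K i)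
    (z x₂ x₃ : Fin n) :
    0 ≤ ∑ a : Fin n,
      (Matrix.of fun (p q : Fin n) =>
          gksExpect Finset.univ K C (fun ω => spinAt p ω * spinAt q ω))⁻¹ z a *
        (gksExpect Finset.univ K C (fun ω => spinAt a ω * spinAt x₂ ω) *
            gksExpect Finset.univ K C (fun ω => spinAt x₃ ω * spinAt x₃ ω) +
          gksExpect Finset.univ K C (fun ω => spinAt a ω * spinAt x₃ ω) *
            gksExpect Finset.univ K C (fun ω => spinAt x₂ ω * spinAt x₃ ω) +
          gksExpect Finset.univ K C (fun ω => spinAt a ω * spinAt x₃ ω) *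
            gksExpect Finset.univ K C (fun ω => spinAt x₂ ω * spinAt x₃ ω) -
          gksExpect Finset.univ K C
            (fun ω => spinAt a ω * spinAt x₂ ω * spinAt x₃ ω * spinAt x₃ ω)) := by
  have h4 : ∀ a : Fin n,
      gksExpect Finset.univ K C (fun ω => spinAt a ω * spinAt x₂ ω * spinAt x₃ ω * spinAt x₃ ω) =
        gksExpect Finset.univ K C (fun ω => spinAt a ω * spinAt x₂ ω) := by
    intro a
    refine congrArg _ (funext fun ω => ?_)
    rw [mul_assoc, spinAt_mul_self, mul_one]
  have hbr : ∀ a : Fin n,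
      gksExpect Finset.univ K C (fun ω => spinAt a ω * spinAt x₂ ω) *
            gksExpect Finset.univ K C (fun ω => spinAt x₃ ω * spinAt x₃ ω) +
          gksExpect Finset.univ K C (fun ω => spinAt a ω * spinAt x₃ ω) *
            gksExpect Finset.univ K C (fun ω => spinAt x₂ ω * spinAt x₃ ω) +
          gksExpect Finset.univ K C (fun ω => spinAt a ω * spinAt x₃ ω) *
            gksExpect Finset.univ K C (fun ω => spinAt x₂ ω * spinAt x₃ ω) -
          gksExpect Finset.univ K C
            (fun ω => spinAt a ω * spinAt x₂ ω * spinAt x₃ ω * spinAt x₃ ω) =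
        (2 * gksExpect Finset.univ K C (fun ω => spinAt x₂ ω * spinAt x₃ ω)) *
          gksExpect Finset.univ K C (fun ω => spinAt a ω * spinAt x₃ ω) := by
    intro a
    rw [h4 a, ampLebDeg_corr_self]
    ring
  simp_rw [hbr]
  rw [ampLebDeg_sum_inv_mul_col]
  have h23 := c5_corr_nonneg K C hK x₂ x₃
  split_ifs <;> positivity

/-- The case `x₂ = x₃`: `ν(z) = 2⟨σ_{x₂}σ_{x₄}⟩ δ_{z x₂} ≥ 0`. -/
theorem ampLebDeg_case23 (n m : ℕ) (K : Fin m → ℝ) (C : Fin m → Finset (Fin n)) (hK : ∀ i, 0 ≤ K i)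
    (z x₂ x₄ : Fin n) :
    0 ≤ ∑ a : Fin n,
      (Matrix.of fun (p q : Fin n) =>
          gksExpect Finset.univ K C (fun ω => spinAt p ω * spinAt q ω))⁻¹ z a *
        (gksExpect Finset.univ K C (fun ω => spinAt a ω * spinAt x₂ ω) *
            gksExpect Finset.univ K C (fun ω => spinAt x₂ ω * spinAt x₄ ω) +
          gksExpect Finset.univ K C (fun ω => spinAt a ω * spinAt x₂ ω) *
            gksExpect Finset.univ K C (fun ω => spinAt x₂ ω * spinAt x₄ ω) +
          gksExpect Finset.univ K C (fun ω => spinAt a ω * spinAt x₄ ω) *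
            gksExpect Finset.univ K C (fun ω => spinAt x₂ ω * spinAt x₂ ω) -
          gksExpect Finset.univ K C
            (fun ω => spinAt a ω * spinAt x₂ ω * spinAt x₂ ω * spinAt x₄ ω)) := by
  have h4 : ∀ a : Fin n,
      gksExpect Finset.univ K C (fun ω => spinAt a ω * spinAt x₂ ω * spinAt x₂ ω * spinAt x₄ ω) =
        gksExpect Finset.univ K C (fun ω => spinAt a ω * spinAt x₄ ω) := by
    intro a
    refine congrArg _ (funext fun ω => ?_)
    have : spinAt a ω * spinAt x₂ ω * spinAt x₂ ω * spinAt x₄ ω =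
        spinAt a ω * spinAt x₄ ω * (spinAt x₂ ω * spinAt x₂ ω) := by ring
    rw [this, spinAt_mul_self, mul_one]
  have hbr : ∀ a : Fin n,
      gksExpect Finset.univ K C (fun ω => spinAt a ω * spinAt x₂ ω) *
            gksExpect Finset.univ K C (fun ω => spinAt x₂ ω * spinAt x₄ ω) +
          gksExpect Finset.univ K C (fun ω => spinAt a ω * spinAt x₂ ω) *
            gksExpect Finset.univ K C (fun ω => spinAt x₂ ω * spinAt x₄ ω) +
          gksExpect Finset.univ K C (fun ω => spinAt a ω * spinAt x₄ ω) *
            gksExpect Finset.univ K C (fun ω => spinAt x₂ ω * spinAt x₂ ω) -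
          gksExpect Finset.univ K C
            (fun ω => spinAt a ω * spinAt x₂ ω * spinAt x₂ ω * spinAt x₄ ω) =
        (2 * gksExpect Finset.univ K C (fun ω => spinAt x₂ ω * spinAt x₄ ω)) *
          gksExpect Finset.univ K C (fun ω => spinAt a ω * spinAt x₂ ω) := by
    intro a
    rw [h4 a, ampLebDeg_corr_self]
    ring
  simp_rw [hbr]
  rw [ampLebDeg_sum_inv_mul_col]
  have h24 := c5_corr_nonneg K C hK x₂ x₄
  split_ifs <;> positivity

/-- The case `x₂ = x₄`: `ν(z) = 2⟨σ_{x₂}σ_{x₃}⟩ δ_{z x₂} ≥ 0`. -/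
theorem ampLebDeg_case24 (n m : ℕ) (K : Fin m → ℝ) (C : Fin m → Finset (Fin n)) (hK : ∀ i, 0 ≤ K i)
    (z x₂ x₃ : Fin n) :
    0 ≤ ∑ a : Fin n,
      (Matrix.of fun (p q : Fin n) =>
          gksExpect Finset.univ K C (fun ω => spinAt p ω * spinAt q ω))⁻¹ z a *
        (gksExpect Finset.univ K C (fun ω => spinAt a ω * spinAt x₂ ω) *
            gksExpect Finset.univ K C (fun ω => spinAt x₃ ω * spinAt x₂ ω) +
          gksExpect Finset.univ K C (fun ω => spinAt a ω * spinAt x₃ ω) *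
            gksExpect Finset.univ K C (fun ω => spinAt x₂ ω * spinAt x₂ ω) +
          gksExpect Finset.univ K C (fun ω => spinAt a ω * spinAt x₂ ω) *
            gksExpect Finset.univ K C (fun ω => spinAt x₂ ω * spinAt x₃ ω) -
          gksExpect Finset.univ K C
            (fun ω => spinAt a ω * spinAt x₂ ω * spinAt x₃ ω * spinAt x₂ ω)) := by
  have h4 : ∀ a : Fin n,
      gksExpect Finset.univ K C (fun ω => spinAt a ω * spinAt x₂ ω * spinAt x₃ ω * spinAt x₂ ω) =
        gksExpect Finset.univ K C (fun ω => spinAt a ω * spinAt x₃ ω) := by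
    intro a
    refine congrArg _ (funext fun ω => ?_)
    have : spinAt a ω * spinAt x₂ ω * spinAt x₃ ω * spinAt x₂ ω =
        spinAt a ω * spinAt x₃ ω * (spinAt x₂ ω * spinAt x₂ ω) := by ring
    rw [this, spinAt_mul_self, mul_one]
  have hbr : ∀ a : Fin n,
      gksExpect Finset.univ K C (fun ω => spinAt a ω * spinAt x₂ ω) *
            gksExpect Finset.univ K C (fun ω => spinAt x₃ ω * spinAt x₂ ω) +
          gksExpect Finset.univ K C (fun ω => spinAt a ω * spinAt x₃ ω) *
            gksExpect Finset.univ K C (fun ω => spinAt x₂ ω * spinAt x₂ ω) +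
          gksExpect Finset.univ K C (fun ω => spinAt a ω * spinAt x₂ ω) *
            gksExpect Finset.univ K C (fun ω => spinAt x₂ ω * spinAt x₃ ω) -
          gksExpect Finset.univ K C
            (fun ω => spinAt a ω * spinAt x₂ ω * spinAt x₃ ω * spinAt x₂ ω) =
        (2 * gksExpect Finset.univ K C (fun ω => spinAt x₂ ω * spinAt x₃ ω)) *
          gksExpect Finset.univ K C (fun ω => spinAt a ω * spinAt x₂ ω) := by
    intro a
    rw [h4 a, ampLebDeg_corr_self, ampLebDeg_corr_comm K C x₃ x₂]
    ring
  simp_rw [hbr]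
  rw [ampLebDeg_sum_inv_mul_col]
  have h23 := c5_corr_nonneg K C hK x₂ x₃
  split_ifs <;> positivity

/-- **Tooth `stub_amputatedLebowitz_degenerate` (coincident triples).** If `x₂, x₃, x₄` are not pairwise
distinct, the VP¹ charge `ν(z) = ∑ₐ (Σ⁻¹)_{z a} (Wick(a; x₂,x₃,x₄) − ⟨σ_aσ_{x₂}σ_{x₃}σ_{x₄}⟩)` of the
zero-field pair ferromagnet `gksExpect univ K C` (`Kᵢ ≥ 0`, `|Cᵢ| = 2`) is nonnegative: two of the three
Wick columns are columns of `Σ` (amputating to Kronecker deltas, `Σ⁻¹Σ = 1` as `Σ` is positive definite,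
`schur_posDef`) and the four-point column collapses to a two-point column (`σ_p² = 1`); e.g. for `x₃ = x₄`,
`ν(z) = 2⟨σ_{x₂}σ_{x₃}⟩ δ_{z x₃} ≥ 0` (GKS I). -/
theorem stub_amputatedLebowitz_degenerate :
    ∀ (n m : ℕ) (K : Fin m → ℝ) (C : Fin m → Finset (Fin n)), (∀ i, 0 ≤ K i) → (∀ i, (C i).card = 2) →
      ∀ z x₂ x₃ x₄ : Fin n, ¬ (x₂ ≠ x₃ ∧ x₂ ≠ x₄ ∧ x₃ ≠ x₄) →
        0 ≤ ∑ a : Fin n,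
          (Matrix.of fun (p q : Fin n) =>
              gksExpect Finset.univ K C (fun ω => spinAt p ω * spinAt q ω))⁻¹ z a *
            (gksExpect Finset.univ K C (fun ω => spinAt a ω * spinAt x₂ ω) *
                gksExpect Finset.univ K C (fun ω => spinAt x₃ ω * spinAt x₄ ω) +
              gksExpect Finset.univ K C (fun ω => spinAt a ω * spinAt x₃ ω) *
                gksExpect Finset.univ K C (fun ω => spinAt x₂ ω * spinAt x₄ ω) +
              gksExpect Finset.univ K C (fun ω => spinAt a ω * spinAt x₄ ω) *
                gksExpect Finset.univ K C (fun ω => spinAt x₂ ω * spinAt x₃ ω) -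
              gksExpect Finset.univ K C
                (fun ω => spinAt a ω * spinAt x₂ ω * spinAt x₃ ω * spinAt x₄ ω)) := by
  intro n m K C hK _hC z x₂ x₃ x₄ hdeg
  have hcase : x₂ = x₃ ∨ x₂ = x₄ ∨ x₃ = x₄ := by
    by_contra hc
    push Not at hc
    exact hdeg ⟨hc.1, hc.2.1, hc.2.2⟩
  rcases hcase with h | h | h
  · subst h
    exact ampLebDeg_case23 n m K C hK z x₂ x₄
  · subst h
    exact ampLebDeg_case24 n m K C hK z x₂ x₃
  · subst h
    exact ampLebDeg_case34 n m K C hK z x₂ x₃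

end Summit.CriticalPhenomena.Ising3DConformalLimit.PrecisionLaplacianMoebiusLimitOfTwoPointLaw

end
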